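import Summits.QuantumAdvantage.QuantumAdvantage.Theorems.CubicForrelationNearExactIsExactCubicFormFrameK
import Summits.QuantumAdvantage.QuantumAdvantage.Theorems.CubicForrelationNearExactIsExactCubicFormRadical
import Summits.QuantumAdvantage.QuantumAdvantage.Theorems.CubicForrelationNearExactIsExactTwelveOddWeightLight

/-!
# Crux `CubicForrelation.NearExactIsExact` (stmt-QuantumAdvantage-14043) — EQUATIONS OF A SUBSPACE: an xor-closed set of bit vectors is cut
  out by parity forms with a dual family (the annihilator), and `#V · 2^r = 2^N`

Certificate seat `b2b-cforr-cert` (gen 41).  HONEST FRAMING: kernel-checked linear algebra over `𝔽₂` (Mathlib; standard axioms) — the bridge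
from the tree's "flat" language (xor-closed `Finset`s, as produced by `mw_flat_of_minweight`, `ffw_minweight_flat`, …KtThreeExceptionalStructure)
to the parity-form language of …CubicFormFrameK (`tcg_adapted_frame_le`: coordinates from forms with a dual family).  Needed for the `T ⊕ T′`
coordinates (the flat of the minimum-weight remainder `g` of `kte_exceptional_structure`) in the Lean roadmap for `E1280-even`
(HOME/b2b-cforr-cert-g41/LEAN-TOOLS-GEN41.md, missing tool (f)).  Nothing about `θ₁₂`; NOT summit progress.

* `tca_annihilator`: for xor-closed `V ∋ 0` in `𝔽₂^N` there are `d + r = N`, parity forms `z₀,…,z_{r−1}` with a dual family `u₀,…,u_{r−1}`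
  such that `V = {x : ⟨x,zᵢ⟩ = 0 ∀ i}`, and `#V · 2^r = 2^N`.  Proof: `V` is a subspace `W`; a basis of `W` extended to a basis of `𝔽₂^N`
  (`tcg_extend`) gives the columns of an invertible `P`; the last `r` rows of `P⁻¹` are the forms, the last `r` columns of `P` the duals;
  the count is …CubicFormRadical `tce_iter_half`.

References: folklore linear algebra.  Axioms: the standard three.
-/

set_option linter.dupNamespace false -- D-0017: single-problem summit ⇒ `QuantumAdvantage.QuantumAdvantage` by design

namespace Summit.QuantumAdvantage.QuantumAdvantage.Theorems.CubicForrelation.NearExactIsExact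

open Finset Module
open Literature.Computability.QuantumComplexity.BuzetChailloux (bxor zeroVec bxor_comm bxor_self bxor_zeroVec zeroVec_bxor
  bxor_bxor_cancel_left)

/-- **Equations of a subspace (annihilator with a dual family).**  See the module docstring. [folklore] -/
theorem tca_annihilator {N : ℕ} (V : Finset (Fin N → Bool)) (h0 : zeroVec ∈ V) (hadd : ∀ x ∈ V, ∀ y ∈ V, bxor x y ∈ V) :
    ∃ (d r : ℕ) (_ : d + r = N) (z u : Fin r → (Fin N → Bool)),
      (∀ i i', decide (Odd #(univ.filter fun j => u i j && z i' j)) = decide (i = i')) ∧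
      (∀ x, x ∈ V ↔ ∀ i, decide (Odd #(univ.filter fun j => x j && z i j)) = false) ∧
      #V * 2 ^ r = 2 ^ N := by
  classical
  -- Bool vectors ↔ 𝔽₂ vectors
  have hpar : ∀ x w : Fin N → Bool, decide (Odd #(univ.filter fun j => x j && w j)) =
      decide ((∑ j, (if x j = true then (1 : ZMod 2) else 0) * (if w j = true then (1 : ZMod 2) else 0)) = 1) := by
    intro x w
    have hs : (∑ j, (if x j = true then (1 : ZMod 2) else 0) * (if w j = true then (1 : ZMod 2) else 0)) =
        ((#(univ.filter fun j => x j && w j) : ℕ) : ZMod 2) := by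
      rw [Finset.natCast_card_filter]
      refine sum_congr rfl fun j _ => ?_
      cases x j <;> cases w j <;> simp
    refine decide_eq_decide.mpr ?_
    rw [hs, ZMod.natCast_eq_one_iff_odd]
  have hadd2 : ∀ a b : ZMod 2, decide (a + b = 1) = (decide (a = 1) ^^ decide (b = 1)) := by decide
  have hread : ∀ t : ZMod 2, (if decide (t = 1) = true then (1 : ZMod 2) else 0) = t := by decide
  have hread' : ∀ y : Bool, decide ((if y = true then (1 : ZMod 2) else 0) = 1) = y := by decide
  set toB : (Fin N → ZMod 2) → (Fin N → Bool) := fun x j => decide (x j = 1) with htoB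
  set toZ : (Fin N → Bool) → (Fin N → ZMod 2) := fun y j => if y j = true then 1 else 0 with htoZ
  have hBZ : ∀ y, toB (toZ y) = y := fun y => by funext j; simp only [htoB, htoZ, hread']
  have hZB : ∀ x, toZ (toB x) = x := fun x => by funext j; simp only [htoB, htoZ, hread]
  have hBadd : ∀ x x', toB (x + x') = bxor (toB x) (toB x') := fun x x' => by
    funext j; simp only [htoB, Pi.add_apply, bxor, hadd2]
  have hB0 : toB 0 = zeroVec := by funext j; rfl
  -- `V` as a submodule
  let W : Submodule (ZMod 2) (Fin N → ZMod 2) :=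
    { carrier := {x | toB x ∈ V}
      add_mem' := fun {x x'} hx hx' => by
        show toB (x + x') ∈ V
        rw [hBadd]; exact hadd _ hx _ hx'
      zero_mem' := by show toB 0 ∈ V; rw [hB0]; exact h0
      smul_mem' := fun c {x} hx => by
        show toB (c • x) ∈ V
        have hc : c = 0 ∨ c = 1 := by revert c; decide
        rcases hc with rfl | rfl
        · rw [zero_smul, hB0]; exact h0
        · rw [one_smul]; exact hx }
  have hWmem : ∀ x, x ∈ W ↔ toB x ∈ V := fun x => Iff.rfl
  -- a basis of `W`, extended to a basis of the whole space
  set d := finrank (ZMod 2) W with hd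
  let bW := Module.finBasis (ZMod 2) W
  have hliW : LinearIndependent (ZMod 2) (fun j : Fin d => ((bW j : W) : Fin N → ZMod 2)) :=
    bW.linearIndependent.map' W.subtype (Submodule.ker_subtype W)
  have hdN : d ≤ N := by
    have := hliW.fintype_card_le_finrank
    rwa [Fintype.card_fin, finrank_fin_fun] at this
  obtain ⟨r, hr⟩ : ∃ r, d + r = N := ⟨N - d, by omega⟩
  obtain ⟨e, he, hebW⟩ := tcg_extend (fun j : Fin d => ((bW j : W) : Fin N → ZMod 2)) hliW r (by rw [finrank_fin_fun]; omega)
  -- reindex along `Fin (d + r) ≃ Fin N` and take `P` with columns `e`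
  let ι : Fin (d + r) ≃ Fin N := finCongr hr
  set e' : Fin N → (Fin N → ZMod 2) := fun φ => e (ι.symm φ) with he'
  have he'li : LinearIndependent (ZMod 2) e' := (linearIndependent_equiv ι.symm).mpr he
  set Pm : Matrix (Fin N) (Fin N) (ZMod 2) := Matrix.of fun ψ φ => e' φ ψ with hPm
  have hcol : Pm.col = e' := by funext φ ψ; rfl
  have hPu : IsUnit Pm := Matrix.linearIndependent_cols_iff_isUnit.mp (by rw [hcol]; exact he'li)
  have hdet : IsUnit Pm.det := (Matrix.isUnit_iff_isUnit_det Pm).mp hPu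
  have hPPi : Pm * Pm⁻¹ = 1 := Matrix.mul_nonsing_inv Pm hdet
  have hPiP : Pm⁻¹ * Pm = 1 := Matrix.nonsing_inv_mul Pm hdet
  have he'col : ∀ φ, e' φ = Pm.col φ := fun φ => by rw [hcol]
  have hιW : ∀ j : Fin d, e' (ι (Fin.castAdd r j)) = (bW j : W) := fun j => by
    rw [he']; simp only [Equiv.symm_apply_apply]; exact hebW j
  have hne : ∀ (j : Fin d) (i : Fin r), ι (Fin.castAdd r j) ≠ ι (Fin.natAdd d i) := fun j i h => by
    have := congrArg Fin.val (ι.injective h); simp at this; omega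
  -- forms = last `r` rows of `P⁻¹`, duals = last `r` columns of `P`
  set z : Fin r → (Fin N → Bool) := fun i => toB (fun j => Pm⁻¹ (ι (Fin.natAdd d i)) j) with hz
  set u : Fin r → (Fin N → Bool) := fun i => toB (e' (ι (Fin.natAdd d i))) with hu
  have hdual : ∀ i i', decide (Odd #(univ.filter fun j => u i j && z i' j)) = decide (i = i') := by
    intro i i'
    rw [hpar]
    have hval : (∑ j, toZ (u i) j * toZ (z i') j) = (Pm⁻¹ * Pm) (ι (Fin.natAdd d i')) (ι (Fin.natAdd d i)) := by
      rw [hu, hz]; simp only [hZB]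
      rw [Matrix.mul_apply]
      exact sum_congr rfl fun j _ => by rw [hPm, Matrix.of_apply]; ring
    have hval' : (∑ j, (if u i j = true then (1 : ZMod 2) else 0) * (if z i' j = true then (1 : ZMod 2) else 0)) =
        (Pm⁻¹ * Pm) (ι (Fin.natAdd d i')) (ι (Fin.natAdd d i)) := hval
    rw [hval', hPiP, Matrix.one_apply]
    by_cases hii : i = i'
    · subst hii; simp
    · rw [if_neg (fun h => hii ((Fin.natAdd_inj d).mp (ι.injective h)).symm), decide_eq_false hii]; decide
  -- coordinates of `x` in the basis: `P⁻¹ x`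
  have hcoord : ∀ (x : Fin N → Bool) (i : Fin r), decide (Odd #(univ.filter fun j => x j && z i j)) =
      decide ((Pm⁻¹.mulVec (toZ x)) (ι (Fin.natAdd d i)) = 1) := by
    intro x i
    rw [hpar]
    refine decide_eq_decide.mpr ?_
    have : (∑ j, (if x j = true then (1 : ZMod 2) else 0) * (if z i j = true then (1 : ZMod 2) else 0)) =
        (Pm⁻¹.mulVec (toZ x)) (ι (Fin.natAdd d i)) := by
      rw [Matrix.mulVec, dotProduct, hz]
      simp only [htoB, htoZ, hread]
      exact sum_congr rfl fun j _ => mul_comm _ _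
    rw [this]
  have h01 : ∀ t : ZMod 2, decide (t = 1) = false ↔ t = 0 := by decide
  have hmem : ∀ x, x ∈ V ↔ ∀ i, decide (Odd #(univ.filter fun j => x j && z i j)) = false := by
    intro x
    simp only [hcoord, h01]
    constructor
    · intro hxV
      have hxW : toZ x ∈ W := by rw [hWmem, hBZ]; exact hxV
      have hrepr := bW.sum_repr ⟨toZ x, hxW⟩
      have hx' : toZ x = ∑ j, (bW.repr ⟨toZ x, hxW⟩ j) • e' (ι (Fin.castAdd r j)) := by
        calc toZ x = (((∑ j, (bW.repr ⟨toZ x, hxW⟩ j) • bW j : W)) : Fin N → ZMod 2) := by rw [hrepr]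
          _ = ∑ j, (bW.repr ⟨toZ x, hxW⟩ j) • e' (ι (Fin.castAdd r j)) := by
            rw [Submodule.coe_sum]
            exact sum_congr rfl fun j _ => by rw [Submodule.coe_smul, hιW j]
      intro i
      rw [hx', Matrix.mulVec_sum]
      simp only [Matrix.mulVec_smul, Finset.sum_apply, Pi.smul_apply, smul_eq_mul]
      refine sum_eq_zero fun j _ => ?_
      rw [he'col, ← Matrix.mulVec_single_one, Matrix.mulVec_mulVec, hPiP, Matrix.one_mulVec, Pi.single_apply,
        if_neg (fun h => hne j i h.symm), mul_zero]
    · intro hzero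
      have hx' : toZ x = ∑ φ, (Pm⁻¹.mulVec (toZ x)) φ • e' φ := by
        have e1 : Pm.mulVec (Pm⁻¹.mulVec (toZ x)) = toZ x := by rw [Matrix.mulVec_mulVec, hPPi, Matrix.one_mulVec]
        conv_lhs => rw [← e1]
        funext ψ
        simp only [Matrix.mulVec, dotProduct, Finset.sum_apply, Pi.smul_apply, smul_eq_mul, hPm, Matrix.of_apply]
        exact sum_congr rfl fun φ _ => mul_comm _ _
      have hxW : toZ x ∈ W := by
        rw [hx', ← Equiv.sum_comp ι, Fin.sum_univ_add]
        have hz' : ∀ i, (Pm⁻¹.mulVec (toZ x)) (ι (Fin.natAdd d i)) • e' (ι (Fin.natAdd d i)) = 0 := fun i => by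
          rw [hzero i, zero_smul]
        simp only [hz', sum_const_zero, add_zero]
        refine W.sum_mem fun j _ => W.smul_mem _ ?_
        rw [hιW j]; exact (bW j).2
      rw [hWmem, hBZ] at hxW
      exact hxW
  refine ⟨d, r, hr, z, u, hdual, hmem, ?_⟩
  -- the count: `r` independent conditions, each halving (translate by the dual vector)
  have hP : ∀ (i : Fin r) (x y : Fin N → Bool), decide (Odd #(univ.filter fun j => bxor x y j && z i j)) =
      (decide (Odd #(univ.filter fun j => x j && z i j)) ^^ decide (Odd #(univ.filter fun j => y j && z i j))) :=
    fun i x y => tow_parity_bxor x y (z i)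
  have e2 := tce_iter_half (univ : Finset (Fin N → Bool)) (fun i x => decide (Odd #(univ.filter fun j => x j && z i j))) u
    (fun k x _ => mem_univ _)
    (fun k x _ => by show decide _ = !decide _; rw [hP, hdual k k, decide_eq_true rfl, Bool.xor_true])
    (fun k i hik x _ => by
      show decide _ = decide _
      rw [hP, hdual k i, decide_eq_false (show ¬ (k = i) from fun h => hik h.symm), Bool.xor_false])
  rw [card_univ, Fintype.card_fun, Fintype.card_bool, Fintype.card_fin] at e2
  rw [← e2]
  congr 2
  ext x
  simp only [mem_filter, mem_univ, true_and]
  exact hmem x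

end Summit.QuantumAdvantage.QuantumAdvantage.Theorems.CubicForrelation.NearExactIsExact
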